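import Summits.QuantumFields.QCD.Theorems.ExtinctionBuildsQCD.Negative.VolumeLever

/-!
# Disproof of `ExtinctionBuildsQCD` — findings (cdisprove seats; crux stmt-QuantumFields-18064,
# RESTATED 2026-08-17 as SD⁺ → THR; filed as stmt-8968 `SD → QCDOf`, then stmt-17572 `SD → THR`)

CURRENT crux (route `SpectralDefectExtinction`, rank 6, BRIDGE over the CAPPED class):
`ExtinctionBuildsQCD := ∀ N_f ∈ {2,3}, SD⁺(N_f) → THR(N_f)` (`extinctionBuildsQCD_iff`, §0), where
`SD⁺(N_f)` (= the body of the restated sibling crux `WindowExtinction`, stmt-18063) says: some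
asymptotically scaling, mass-scaling Wilson regularisation `reg` with POLYNOMIALLY CAPPED volumes
(`∃ p, ∀ᶠ k, L_k ≤ a_k^{-p}`) and line on the PHYSICAL BRANCH (`∀ᶠ k, −1 < m_crit(k)`) is SPECTRALLY
CLEAN — (EXTINCT) the phase-quenched expected number of sign defects (real eigenvalues of `D_W(U,0,1)`
below `-m_f(k)`) and coercivity defects (eigenvalues of `γ₅ D_W(U,m_f(k),1)` in
`(-c a_k m_f/Z_k, c a_k m_f/Z_k)`) is `o(volume ratio)` — and EXTENSIVELY TIGHT (TIGHT⁺): the expected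
`|n₋(γ₅ D_W(U, m_crit(k) - a_k M/Z_k, 1)) - 6(2L_k+1)⁴|` is `≥ max 1 (η (a_k(2L_k+1))²)` just past the
line; `THR(N_f)` = massive QCD above a threshold along one mass-scaling regularisation (the antecedent of
the proved support `ThresholdForm`).  THE 2026-08-17 CYCLES ON THE RESTATED CRUX ARE §7, §8, §9 AND §10 (end of file; read §10
first — g4 seat: STILL NO `¬S` TO FILE (second `file-refutation` re-seat; cause of the loop and the DONE-line rule in §10o);
the hand-back's GROWTH clause `a_k L_k/Z_k → ∞` CERTIFIED BOTH WAYS — sufficient for the F/W proviso, safe but not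
junk-excluding (LANDED `Negative/VolumeGrowth.lean` p154859, commit 7d5e387d4790; `bridgePlusGrowthWithoutTight_iff_thr` below); line v14 = v13,
lead c3 handed back; then §9 — g3 seat: NO KILL EXISTS TO FILE (the harness's "file-refutation" re-seat rests on a misparse: the
`refuted-misstated` token in g2's DONE line is rattack-17812's verdict on the NODE stmt-17812, not on this crux; kill
shape unchanged, needs `¬THR`); the lead's `disprover-wanted: blocked positivity` ANSWERED (no coarse field forces a
|det|-majority of sign-defective fine fields — but minority is the wrong currency on large tori: parity factorisation
is what G1 must prove); the total-mass attack on G1 is VOID (format free constant, `Negative/FormatFreeConstant.lean`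
p152146); then §8 — g2 seat: LINE AUDIT of `block-away-the-sign` v7 (stubs R / C′ / T), the extensive pin LANDING
`Negative/ExtensivePin.lean` p148475 and `Negative/VolumeFloor.lean` p149644 LANDED, cap-redundancy and b.c.-scale
findings; then §7): load-bearing analysis of the three new clauses (only TIGHT⁺ is junk-excluding; landing
`Negative/WithoutTightPlusCollapse.lean` p135995), the extensive two-sided pin, why SD⁺ has no junk
inhabitant in sight, kill shape, and an INTEGRITY NOTE on the stale `Negative/*` oleans.  §0 below is
re-typed to the restated bodies; §1–§6 (cycles 1–3 on the filed text) are statements about SD-witnesses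
and apply to SD⁺-witnesses verbatim via `sdHyp_of_sdPlus`; §2/§4's collapse results are kept as facts
about the RETIRED text (`FiledBridge`, `FiledHinge`).

FILED crux (for §1–§6): `SD(N_f)` = the same without cap, branch and with the floor `1` (TIGHT).

LAYOUT (2026-08-17): this ENTRY file holds the findings index, the re-typed shape §0′ and the CURRENT cycle §7, and
imports only LANDED AND BUILT modules (`Negative/VolumeLever` → `TightPinsLine` → `WithoutTightCollapse`, `ChiralInertia`), declaring into the fresh
namespace `…Disproof.Restated`; §0–§6 (theorems of cycles 1–3, §0/§4/§6d re-typed to the restated bodies, rc 0) live in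
`DisproofBase.lean` next to this file (namespace `…Disproof`; not imported here only because the farm had not built it within
the session — a later seat may `import …Cruxes.ExtinctionBuildsQCD.DisproofBase` and drop the `Restated` copies of
`TightPlus`/`SDPlus`/`THR`).  §7b's theorems are LANDED in `Negative/TwoSidedPin.lean` (p136280, floor `1`) and drafted in the
seat folder's `drafts/…/Negative/ExtensivePin.lean` (extensive floor; also in `DisproofBase`-style form in the folder copy).

## Findings (all theorems below and in `DisproofBase.lean` are sorry-free; LANDED certified copies under
`Summits/QuantumFields/QCD/Theorems/ExtinctionBuildsQCD/Negative/`: `WithoutTightCollapse.lean`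
(§0–§2, p72916), `ChiralInertia.lean` (§3 matrix part, p73455), `TightPinsLine.lean` (§3, p73943),
`VolumeLever.lean` (§4, cycle 2, p75044), `InertiaPencil.lean` / `CrossingBudget.lean` / `IndexBudget.lean`
(§5, cycle 2), `WeylWindow.lean` / `ExtinctIntegrable.lean` / `CoercivityCeiling.lean` / `TwoSidedPin.lean` (§6, cycle 3); on the
restated crux `WithoutTightPlusCollapse.lean` (§7, p135995), `ExtensivePin.lean` (§7b/§8d, p148475), `VolumeFloor.lean` (§8b, p149644),
`FormatFreeConstant.lean` (§9a, p152146), `VolumeGrowth.lean` (§10a, p154859) — import those rather than this work file)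

* §0 SHAPE (re-typed 2026-08-17).  `¬ ExtinctionBuildsQCD ↔ ∃ N_f ∈ {2,3}, SD⁺(N_f) ∧ ¬ THR(N_f)`
  (`not_extinctionBuildsQCD_iff`), `THR 2 → THR 3 → ExtinctionBuildsQCD`, `QCD → ExtinctionBuildsQCD`
  (`extinctionBuildsQCD_of_thr`, `extinctionBuildsQCD_of_qcd`), `¬ ExtinctionBuildsQCD → ¬ QCD`, and the
  sandwich `WindowExtinction → (ExtinctionBuildsQCD ↔ THR 2 ∧ THR 3)`.  An UNCONDITIONAL kill of this
  crux therefore needs `¬ THR` ("no massive QCD above any threshold") — out of reach of counterexample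
  search.  WHY IT RESISTS: implication-shaped crux with a summit-hard, unrefuted consequent; the only
  cheap kills would be (i) SD⁺ junk-satisfiable AND THR refutable (no), or (ii) SD⁺ refutable (then the
  bridge is vacuously TRUE, not false; that is the sibling crux's kill, and not cheap either, §7c).

* §1 SPECTRAL FACTS (configuration-wise, every `SU(3)` field, every torus):
  `countP_signDefect_eq_zero` — the massless `r = 1` Wilson–Dirac operator has NO real eigenvalue
  `< t` for any `t ≤ 0` (heavy-mass invertibility `wilsonDirac_det_ne_zero_of_pos`);
  `le_abs_re_of_mem_roots_hermitianWilson` — every eigenvalue `λ` of `γ₅ D_W(U, μ, 1)` with `μ ≥ 0`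
  has `|λ| ≥ μ` (Wilson positivity `Re⟨ψ, D_W(U,0,1)ψ⟩ ≥ 0` via `D = 4 − ΣW_μ`, `‖W_μ‖ ≤ 1`, and `Γ₅² = 1`);
  `re_mem_Icc_of_real_root` — every real eigenvalue of `D_W(U,0,1)` lies in `[0, 8]`;
  hence `countP_coercivityDefect_eq_zero` — no eigenvalue of `γ₅ D_W(U, μ, 1)` in `(-cμ', cμ')`
  when `c μ' ≤ μ`.

* §2 LOAD-BEARING ANALYSIS.  `extinct_of_mcrit_nonneg`: for EVERY regularisation whose line is put
  at non-negative bare mass (`m_crit(k) ≥ 0`), EXTINCT holds for every `c ∈ (0,1]` and every positive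
  mass tuple, with the defect integrand IDENTICALLY ZERO (no measure theory, no weak coupling, no
  asymptotic freedom used).  Consequently (`sdWithoutTight_canonicalAF`) the degenerate tree
  regularisation `QCDRegularisation.canonicalAF N_f` (`m_crit ≡ 0`, `Z_m = (log a⁻²)^{γ₀/2β₀}`,
  `β_k = afBeta`) satisfies `SD` minus TIGHT, and
  `extinctionBuildsQCDWithoutTight_iff_qcd : ExtinctionBuildsQCDWithoutTight ↔ QCD`:
  WITHOUT THE TIGHT CLAUSE THE BRIDGE IS LITERALLY THE SUMMIT CONJUNCT.  Any proof of the crux must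
  therefore extract its fermionic input from TIGHT jointly with EXTINCT; EXTINCT alone (both the
  sign-defect and the coercivity-defect counts, at any `c ≤ 1`) carries no information.
  The same witness kills the natural strengthening "TIGHT replaced by a sign/interval condition on
  `m_crit(k)`" (`extinctionBuildsQCDWithLinePinned_iff_qcd`, schema `bridge_collapse_schema`): pinning the line to
  `m_crit(k) ∈ [-8, 0]` is not a substitute for the index content of TIGHT.

* §3 TIGHT PINS THE LINE (chiral inertia, fully proved).  `card_le_card_eigenvalues_of_form_pos`
  (Sylvester, one direction, for `Matrix.IsHermitian.eigenvalues` via `eigenvectorUnitary`) and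
  `countP_neg_eq_of_chiral`; for the Wilson operator: `negCount_hermitianWilson_eq` — for EVERY
  `SU(3)` field on a torus of side `L` and every probe mass `m₀ > 0` or `m₀ < -8`,
  `γ₅ D_W(U, m₀, 1)` has EXACTLY `6 L⁴` negative eigenvalues (the form `⟨v, γ₅ D v⟩ = ±Re⟨v, Dv⟩` is
  definite on the two `6L⁴`-dimensional chirality sectors `spinEmbed 0/2`, and
  `m Σ‖v‖² ≤ Re⟨v,D_W(m)v⟩ ≤ (m+8)Σ‖v‖²`).  Hence the TIGHT integrand `|n₋ − 6(2L_k+1)⁴|` vanishes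
  identically off `[-8, 0]` and `Tight.eventually_probe_mem`: TIGHT forces
  `m_crit(k) − a_k M/Z_m(k) ∈ [-8, 0]` eventually, for every `M > M₀` (`SDHyp.line_pinned`).
  INDEPENDENCE (`tight_independent`, `N_f ≤ 16`): the junk regularisation `shiftedAF`
  (`canonicalAF` with `m_crit ≡ 1`) is mass-scaling, asymptotically scaling, satisfies EXTINCT for
  all positive masses and FAILS TIGHT for every `M₀ ≥ 0` and every mass tuple — TIGHT is not a
  consequence of the other clauses.  What TIGHT asks INSIDE `(-8, 0)` — `E₊|index| ≥ 1` at weak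
  coupling on `(2L_k+1)⁴ ≫ a_k⁻⁴` sites — is a statement about the topological charge distribution
  of lattice `SU(3)` gauge theory (`E|Q| → ∞`), physically true, far from provable-now, and NOT
  dischargeable by any configuration-wise argument (for `U = 1` the spectrum is balanced at every
  `m₀ ≠ 0`), which is why no junk witness for the full `SD` is in sight: the crux does not collapse
  to the summit, and it cannot be killed without `¬QCDOf`.

* §4 THE VOLUME LEVER (cycle 2).  `SD` constrains the volumes only by `a_k L_k → ∞`
  (`QCDRegularisation.tendsto_L`); `HasMassScaling`/`HasAsymptoticScaling` do not see `L`
  (`withVolume_*_iff`, `rfl`), EXTINCT is free at every volume for `m_crit ≥ 0`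
  (`extinct_withVolume_of_mcrit_nonneg`), and TIGHT lives on the scheme's OWN torus
  (`tight_iff_tightRatio`).  Hence on the tip family `tipReg L'` (`canonicalAF` with free volumes) the
  whole of `SD(N_f)` is the fixed-cutoff infinite-volume statement `IndexSpreadBox N_f` (phase-quenched
  `E|index| ≥ 1` at probe `-a_k M/Z_k` on all large tori, at the bare parameters of ONE step `k`):
  `tight_tipReg_of_indexSpreadBox`, `sdHyp_of_indexSpreadBox : IndexSpreadBox N_f → SD(N_f)`,
  `windowExtinction_of_indexSpreadBox`, and
  `extinctionBuildsQCD_iff_qcd_of_indexSpreadBox : IndexSpreadBox 2 → IndexSpreadBox 3 → (ExtinctionBuildsQCD ↔ QCD)`,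
  robust under any side condition the tip family meets (`collapse_schema_of_indexSpreadBox`, e.g. the
  physical-branch clause `-1 < m_crit ≤ 0`, `collapse_with_branchClause_of_indexSpreadBox`).
  `IndexSpreadBox` is heuristically TRUE (positive rate of tip real modes from instantons in cold patches,
  reflection symmetry of the index law, decorrelation of distant patches — §4 docstring) and contains no
  continuum limit: IN TRUTH-VALUE THE BRIDGE IS THE SUMMIT and the pin is defeated by entropy the witness
  controls.  Repairs for the planner: (R1) `L_k ≤ a_k^{-p}`; (R2) extensive TIGHT
  `E₊|index| ≥ η (a_k(2L_k+1))²`; (R3) TIGHT on a torus of fixed physical multiple.  Not a refutation: the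
  central-limit part of `IndexSpreadBox` is not provable now, and even with it the crux stays `QCD`-hard.

* §5 INDEX BUDGET (cycle 2, configuration-wise, all `U`).  `abs_negCount_hermitianWilson_sub_le`:
  `|n₋(Γ₅D_W(U,b,1)) − n₋(Γ₅D_W(U,a,1))| ≤ #{real eigenvalues of D_W(U,0,1) in [−b,−a]}` (ideator-3's stub
  `negCount_sub_le_realBandCount`, PROVED: Sylvester local inertia along the pencil + nullity ≤ algebraic
  multiplicity + connectedness); `abs_index_le_realModeCount`: `|index(p)| ≤ #{real λ ≤ −p}`;
  `tight_integrand_le_signDefects_add_band`; `index_eq_zero_of_no_realMode`.  So TIGHT is met ONLY by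
  real modes in `[0, a_kM/Z_k − m_crit(k)]`: tip modes for the tip family (this is what `IndexSpreadBox`
  is about), band modes at the line for an honest witness.

* §6 COERCIVITY CEILING AND THE TWO-SIDED PIN (cycle 3; landing `Negative/{WeylWindow,ExtinctIntegrable,
  CoercivityCeiling,TwoSidedPin}.lean`). Weyl window budget `|n₋(H_W(a)) − n₋(H_W(b))| ≤ #{|λ(H_W(a))| ≤ |b−a|}`
  (`abs_negCount_sub_le_windowCount`); TIGHT's integrand `≤ #{|λ(H_W(m_f(k)))| ≤ a_k(m_f+M)/Z_k} + #{real λ(D_W(0)) ≤ −m_f(k)}`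
  pointwise; the EXTINCT integrand is INTEGRABLE (`integrable_extinctIntegrand`, via the landed root-count
  measurability); hence `c_le_one_of_extinct_tight`: EVERY `SD` witness has `c ≤ 1` (the strengthening "`SD` with
  `c > 1`" is unsatisfiable, `not_sdHyp_with_one_lt`), and the POSITIVE content of the hypothesis is the two-sided
  pin in three currencies, `E₊[window_f] ≥ 1−ε`, `E₊[band_f] ≥ 1−ε`, `E₊[shell_f] ≥ 1−ε` eventually
  (`eventually_{window,band,shell}Ratio_ge`, `seaShellPin` = card `weyl-transport-unitary-pin`'s stub, proved,
  `SDHyp.two_sided_pin`) — near-zero modes of `H_W` AT THE FLAVOUR (unitary) MASS at scale `a_k m_f/Z_k`: the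
  witness's line is critical and its coercivity is exactly the bare distance to the line, never better.

* Dead ends (one line each): junk `m_crit → ±∞` / `Z_m → 0⁺` / `Z_m → ∞` witnesses all make the
  TIGHT integrand `0` (§3); `SD` unsatisfiable via integrability junk — no: all integrands are
  bounded (counts `≤ 12(2S+1)⁴`, `|det|` continuous on a compact group), `wilsonMeasure` is a
  probability measure, denominators are `> 0` (`|det| > 0` off a null set); formal bug in `QCDOf`
  making it refutable — none found (8 audits; `HasLatticeMassGap` quantifies `∃ C` after `A, B`,
  tori eventually exceed supports, twisted-trace reading documented).
-/

namespace Summit.QuantumFields.QCD.Cruxes.ExtinctionBuildsQCD.Disproof.Restated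

open scoped BigOperators Topology Classical MeasureTheory Matrix ComplexConjugate
open Filter MeasureTheory Matrix
open Literature.MathematicalPhysics.QuantumLattice Literature.MathematicalPhysics.QuantumFieldTheory
  Literature.Probability.LatticeModels
open Summit.QuantumFields.QCD.Theses.SpectralDefectExtinction
open Summit.QuantumFields.QCD.Theorems.ExtinctionBuildsQCD.Negative

/-! ## §0′ Shape of the RESTATED crux (the filed clauses `Extinct`/`Tight`/`SDHyp` are the landed
`Negative/WithoutTightCollapse` ones; `TightPlus`/`SDPlus`/`THR` twin the landed `Negative/WithoutTightPlusCollapse`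
defs `TightPlus`/`SDPlusHyp`/`Threshold`, re-declared here only because that module was not yet built on the farm) -/

/-- TIGHT⁺ of `SD⁺(N_f)` (verbatim clause of the RESTATED crux, stmt-18063/18064): TIGHT with the floor
`1` raised to `max 1 (η (a_k(2L_k+1))²)` — the extensive (Leutwyler–Smilga `√V_phys`) pin. -/
def TightPlus (Nf : ℕ) (reg : QCDRegularisation Nf) (M₀ : ℝ) (m : Fin Nf → ℝ) : Prop :=
  ∃ η : ℝ, 0 < η ∧ ∀ M : ℝ, M₀ < M → ∀ᶠ k : ℕ in Filter.atTop, max 1 (η * (reg.a k * (2 * reg.L k + 1 : ℝ)) ^ 2) ≤ (∫ U, (|(Multiset.countP (fun z : ℂ => z.re < 0) (spinorLift gammaFive * wilsonDirac (fundamentalRep (Fin 3)) U (reg.mcrit k - reg.a k * M / reg.Zm k) 1).charpoly.roots : ℝ) - 6 * (2 * reg.L k + 1 : ℝ) ^ 4|) * ∏ f : Fin Nf, ‖fermionDet (wilsonDirac (fundamentalRep (Fin 3)) U (reg.mcrit k + reg.a k * m f / reg.Zm k) 1)‖ ∂(wilsonMeasure (d := 4) (L := 2 * reg.L k + 1) (fundamentalRep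 (Fin 3)) (reg.β k))) / (∫ U, ∏ f : Fin Nf, ‖fermionDet (wilsonDirac (fundamentalRep (Fin 3)) U (reg.mcrit k + reg.a k * m f / reg.Zm k) 1)‖ ∂(wilsonMeasure (d := 4) (L := 2 * reg.L k + 1) (fundamentalRep (Fin 3)) (reg.β k)))

/-- `SD⁺(N_f)`: the hypothesis of the RESTATED bridge (= body of the restated `WindowExtinction`,
stmt-18063): SD + (R1) polynomial volume cap `∃ p, ∀ᶠ k, L_k ≤ a_k^{-p}` + (BRANCH) `∀ᶠ k, −1 < m_crit(k)`
+ (R2) TIGHT⁺ in place of TIGHT. -/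
def SDPlus (Nf : ℕ) : Prop :=
  ∃ reg : QCDRegularisation Nf, reg.HasMassScaling ∧ (reg.scheme 0 0 0).HasAsymptoticScaling ∧
    (∃ p : ℕ, ∀ᶠ k : ℕ in Filter.atTop, (reg.L k : ℝ) ≤ (reg.a k)⁻¹ ^ p) ∧ (∀ᶠ k : ℕ in Filter.atTop, -1 < reg.mcrit k) ∧
      ∃ M₀ : ℝ, 0 ≤ M₀ ∧ ∃ c : ℝ, 0 < c ∧ ∀ m : Fin Nf → ℝ, (∀ f, M₀ < m f) → Extinct Nf reg c m ∧ TightPlus Nf reg M₀ m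

/-- `THR(N_f)`: the conclusion of the RESTATED bridge — massive QCD above a threshold along one
mass-scaling regularisation (verbatim; the antecedent of the route's `ThresholdForm` / `ChiralDescent`). -/
def THR (Nf : ℕ) : Prop :=
  ∃ reg : QCDRegularisation Nf, reg.HasMassScaling ∧ ∃ M₁ : ℝ, 0 ≤ M₁ ∧ ∀ m : Fin Nf → ℝ, (∀ f, M₁ < m f) → ∃ (z shift : QCDField Nf → ℕ → ℝ) (T : OSData (QCDField Nf) 4), IsQCDAlong (reg.scheme m z shift) T ∧ T.IsNontrivial QCDField.glue ∧ T.IsNonGaussian QCDField.glue ∧ (∀ f g : Fin Nf, f ≠ g → T.IsNontrivial (QCDField.pseudoRe f g)) ∧ ∃ Δ > 0, T.HasMassGap Δ ∧ (reg.scheme m z shift).HasLatticeMassGap Δ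

/-- `FiledBridge`: the crux AS FILED (stmt-8968 text, `∀ N_f ∈ {2,3}, SD(N_f) → QCDOf N_f`) — kept as a
local record so that the cycle-1/2 findings about the retired text (§2, §4) keep elaborating. -/
def FiledBridge : Prop :=
  ∀ Nf : ℕ, (Nf = 2 ∨ Nf = 3) → SDHyp Nf → QCDOf Nf

/-- `FiledHinge`: the sibling crux AS FILED (stmt-8964 text, `∀ N_f ∈ {2,3}, SD(N_f)`). -/
def FiledHinge : Prop :=
  ∀ Nf : ℕ, (Nf = 2 ∨ Nf = 3) → SDHyp Nf

/-- The RESTATED crux, unbundled: `ExtinctionBuildsQCD` is `∀ N_f ∈ {2,3}, SD⁺(N_f) → THR(N_f)`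
(definitional; stmt-18064). -/
theorem extinctionBuildsQCD_iff :
    ExtinctionBuildsQCD ↔ ∀ Nf : ℕ, (Nf = 2 ∨ Nf = 3) → SDPlus Nf → THR Nf := Iff.rfl

/-- The RESTATED sibling crux, unbundled: `WindowExtinction` is `∀ N_f ∈ {2,3}, SD⁺(N_f)` (definitional; stmt-18063). -/
theorem windowExtinction_iff : WindowExtinction ↔ ∀ Nf : ℕ, (Nf = 2 ∨ Nf = 3) → SDPlus Nf :=
  Iff.rfl

/-- TIGHT⁺ implies the filed TIGHT (`1 ≤ max 1 _`). -/
theorem tight_of_tightPlus {Nf : ℕ} {reg : QCDRegularisation Nf} {M₀ : ℝ} {m : Fin Nf → ℝ}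
    (h : TightPlus Nf reg M₀ m) : Tight Nf reg M₀ m := by
  obtain ⟨η, -, h⟩ := h
  intro M hM
  filter_upwards [h M hM] with k hk
  exact le_trans (le_max_left _ _) hk

/-- SD⁺ implies the filed SD: EVERY finding below about SD-witnesses (§1–§6) applies to SD⁺-witnesses. -/
theorem sdHyp_of_sdPlus {Nf : ℕ} (h : SDPlus Nf) : SDHyp Nf := by
  obtain ⟨reg, hms, has, -, -, M₀, hM₀, c, hc, h⟩ := h
  exact ⟨reg, hms, has, M₀, hM₀, c, hc, fun m hm => ⟨(h m hm).1, tight_of_tightPlus (h m hm).2⟩⟩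

/-- The restated hinge implies the filed one. -/
theorem filedHinge_of_windowExtinction (h : WindowExtinction) : FiledHinge :=
  fun Nf hNf => sdHyp_of_sdPlus (h Nf hNf)

/-- `QCDOf N_f → THR(N_f)` (threshold `M₁ = 0`; the chiral clause of the re-typed `QCDOf` is dropped). -/
theorem thr_of_qcdOf {Nf : ℕ} (h : QCDOf Nf) : THR Nf := by
  obtain ⟨reg, hms, -, hbody⟩ := h
  exact ⟨reg, hms, 0, le_rfl, hbody⟩

/-- The bridge follows outright from its own conclusion at both flavour numbers (SD⁺ unused): the
restated crux is AT MOST "massive QCD above a threshold"-hard (cf. ideator 2's Occam sandwich: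
`HeavyThresholdYMBridge.ThresholdQCD → ExtinctionBuildsQCD`). -/
theorem extinctionBuildsQCD_of_thr (h2 : THR 2) (h3 : THR 3) : ExtinctionBuildsQCD := by
  intro Nf hNf _
  rcases hNf with rfl | rfl
  exacts [h2, h3]

/-- The summit conjunct implies the crux outright: the bridge is AT MOST summit-hard. -/
theorem extinctionBuildsQCD_of_qcd (h : _root_.QCD) : ExtinctionBuildsQCD :=
  extinctionBuildsQCD_of_thr (thr_of_qcdOf h.1) (thr_of_qcdOf h.2)

/-- Contrapositive: any refutation of the crux refutes the summit conjunct `QCD`. -/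
theorem not_qcd_of_not_extinctionBuildsQCD (h : ¬ ExtinctionBuildsQCD) : ¬ _root_.QCD :=
  fun hq => h (extinctionBuildsQCD_of_qcd hq)

/-- What a kill would have to exhibit: a flavour number with a capped, branched, extensively tight
spectrally clean regularisation AND no massive QCD above any threshold along any mass-scaling
regularisation (`¬ THR` — the negation of the threshold form of the summit conjunct). -/
theorem not_extinctionBuildsQCD_iff :
    ¬ ExtinctionBuildsQCD ↔ ∃ Nf : ℕ, (Nf = 2 ∨ Nf = 3) ∧ SDPlus Nf ∧ ¬ THR Nf := by
  rw [extinctionBuildsQCD_iff]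
  push Not
  rfl

/-- **The crux sandwiched.** Given the sibling crux (by ANY witnesses) the bridge is EQUIVALENT to its
conclusion `THR 2 ∧ THR 3`; what keeps it from BEING its conclusion is exactly the absence of a junk
inhabitant of SD⁺ (§7). -/
theorem extinctionBuildsQCD_iff_thr_of_windowExtinction (hSD : WindowExtinction) :
    ExtinctionBuildsQCD ↔ THR 2 ∧ THR 3 :=
  ⟨fun h => ⟨h 2 (Or.inl rfl) (hSD 2 (Or.inl rfl)), h 3 (Or.inr rfl) (hSD 3 (Or.inr rfl))⟩,
    fun hq => extinctionBuildsQCD_of_thr hq.1 hq.2⟩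


/-! ## §7 (2026-08-17, cdisprove seat on the RESTATED crux stmt-QuantumFields-18064) — SD⁺ → THR

The restatement (route-repair after `refuted-misstated` on stmt-17572) replaced SD by
SD⁺ = SD ∧ (R1) `∃ p, ∀ᶠ k, L_k ≤ a_k^{-p}` ∧ (BRANCH) `∀ᶠ k, −1 < m_crit(k)` ∧ (R2) TIGHT⁺ (floor
`max 1 (η (a_k(2L_k+1))²)`), and the conclusion by THR.  Findings of this cycle (landing:
`Negative/WithoutTightPlusCollapse.lean`, p135995):

* §7a LOAD-BEARING ANALYSIS OF THE NEW CLAUSES (theorems).  `canonicalAF` MEETS the cap (`p = 2`,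
  `canonicalAF_cap`) and the branch clause (`canonicalAF_branch`); with `extinct_of_mcrit_nonneg` it
  inhabits SD⁺ minus TIGHT⁺ (`sdPlusWithoutTight_canonicalAF`), so `BridgePlusWithoutTight ↔ THR 2 ∧ THR 3`
  (`bridgePlusWithoutTight_iff_thr`) and the same for every TIGHT⁺-replacement met by `canonicalAF`
  (`bridgePlus_collapse_schema`).  R1 and BRANCH are NOT junk-excluding on their own: any proof of the
  restated crux must extract its fermionic input from TIGHT⁺ (jointly with EXTINCT).  SD⁺ ⇒ SD
  (`sdHyp_of_sdPlus`, §0), so §1–§6 apply to SD⁺-witnesses verbatim; with BRANCH the line is pinned into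
  `(−1, a_k M/Z_k]` eventually (`SDPlus.line_mem`), and `c ≤ 1` (`SDPlus.c_le_one`, §6d).  TARGET NOTE: the three lines' transfer stub (`stub_cappedWitness` ≡
  `stub_honestWitness` ≡ `stub_volumeCap`, typed from the FILED `SDHyp`) is a projection of SD⁺ once its antecedent is
  retyped (`cappedWitness_of_sdPlus`; landed twin in `Negative/ExtensivePin.lean`).
* §7b THE EXTENSIVE TWO-SIDED PIN (theorems).  For SD⁺-witness data, every flavour `f`, `M > M₀`, `ε > 0`:
  eventually `E₊[window_f] ≥ max 1 (η (a_k(2L_k+1))²) − ε`, and the same for the band (real modes of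
  `D_W(U,0,1)` in `[−m_f(k), −m_crit(k) + a_kM/Z_k]`) and the unitary shell
  (`eventually_{window,band,shell}Ratio_ge_floor`, LANDED/drafted, see §7b): what the restated hypothesis hands a bridge prover is
  `≳ η √V_phys` near-zero modes of `H_W` AT THE FLAVOUR MASS in an `a_k(m_f+M)/Z_k`-window, resp. as many
  real modes of the massless Wilson operator in the band at the line — the Banks–Casher / Leutwyler–Smilga
  currency of TIGHT⁺ in three forms, while EXTINCT(b) empties the inner collar `|λ| < c a_k m_f/Z_k`.
* §7c WHY SD⁺ HAS NO JUNK INHABITANT IN SIGHT (heuristic; no theorem either way).  (i) Structure fields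
  force `a_k → 0`, `a_k L_k → ∞`, `Z_k > 0`; `HasMassScaling` pins `Z_k ∼ c (log a_k⁻²)^γ`, asymptotic
  scaling pins `β_k = afBeta(Λ, a_k) + o(1) → ∞`; so no fixed-volume / `L_k = 0` / fixed-`β` junk, and the
  floor `η (a_k(2L_k+1))² → ∞`.  (ii) The capped TIP FAMILY (`m_crit ≡ 0`, EXTINCT free): its index carriers
  are real modes of `D_W(U,0,1)` in `(0, a_kM/Z_k]`; such a mode is extended over `≳ Z_k/(a_kM)` sites and
  needs a cold patch of that size with local mass shift `≤ a_kM/Z_k ≪ |m_c(β_k)| ≍ 0.87/β_k` — a Gaussian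
  small-ball event of cost `exp(−C (Z/aM)⁴ β)`, super-exponential in `β`; on `≤ a_k^{−4p}` sites even the
  filed floor `1` fails.  Under the cap, TIGHT⁺'s extra job over TIGHT is only the CLT-scale normalisation
  (kill lines carried by `O(1)` expected carriers per scheme torus).  (iii) A GENERAL LINE at depth
  `t* = |m_crit(k)| ∈ (0, 1)`: EXTINCT(a) (cumulative sub-line real-mode count on the WHOLE scheme torus
  `→ 0`) and TIGHT (window count `≥ 1`) together demand an EDGE of the real-mode depth distribution at `t*`
  sharp to `o(a_k/Z_k)`: where the log-density `4b₀ s(t) log a⁻¹` of depth-`t` carriers is Lipschitz in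
  `t`, Laplace gives cumulative/window `≍ Z/(a · 4b₀|s'| log a⁻¹) → ∞`, contradiction.  Edges in sight:
  the tip `0` (dead under the cap, (ii)) and the physical accumulation edge `|m_c(β)|` (honest; DRESS
  lore; DATA: Edwards–Heller–Narayanan 1998, hep-lat/9802016 pp. 4–5, 10 — quenched SU(3) at
  β_W = 5.7–6.0: the crossings of `H_W(m)` START at an edge `m₁ < m_c` that decreases toward weak
  coupling, the condensate peaks "very close to m₁" and the susceptibility rises sharply there; modes
  crossing near `m₁` are several lattice spacings large, modes crossing deep in region II (depth
  `> |m_c|`, seen by NEITHER clause of SD⁺) are 1–2 spacings; with dynamical Wilson quarks the gap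
  closes only beyond the dynamical bare mass).  The honest SD⁺ line is this edge, and SD⁺ needs
  `m_c − m₁ = o(a_k/Z_k)` asymptotically (else the witness's physical masses diverge like
  `Z_k (m_c − m₁)/a_k`) — expected, since a physical-size instanton crosses within `O(a²)` of the chiral
  point and its UV dressing self-averages to `O(a²/(β ρ²))`, both `≪ a/Z`.  No third edge ⇒ no junk
  witness; and none of (ii)–(iii) is provable here in either direction
  (lower bounds: anti-concentration of a global spectral functional under the SU(3) Wilson measure at
  weak coupling; upper bounds: Wegner/large-deviation estimates, Bałaban class).  (iv) All witness
  constants (`Λ`, the unit `c` of `Z_m`, `η`, `c`, `M₀`, `p`) die against `∀ M, ∀ᶠ k` and the exponential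
  rates; Bochner / measurability / zero-denominator junk: none (§6c; `|det| > 0` off a null set).
* §7d KILL SHAPE (§0): `¬ ExtinctionBuildsQCD ↔ ∃ N_f ∈ {2,3}, SD⁺(N_f) ∧ ¬ THR(N_f)`; `¬ THR` = "no
  massive QCD above any threshold along any mass-scaling regularisation" — the negation of the threshold
  form of the summit conjunct, out of reach.  Given the sibling crux the bridge is EQUIVALENT to
  `THR 2 ∧ THR 3` (`extinctionBuildsQCD_iff_thr_of_windowExtinction`): the crux is an honest
  (≥ YM-grade) cut exactly insofar as SD⁺ has no junk inhabitant.  NO KILL this cycle.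
* §7e INTEGRITY NOTE (for the operator / planner).  After the two restatements the landed root module
  `Negative/WithoutTightCollapse` (§0: `extinctionBuildsQCD_iff`, `windowExtinction_iff`,
  `not_extinctionBuildsQCD_iff`), `VolumeLever` (`extinctionBuildsQCD_iff_qcd_of_indexSpread`, `not_…`),
  `VolumeLeverBox` (same, `Box`), `CoercivityCeiling.windowExtinction_c_le_one` and all of
  `ThresholdCollapse` are typed against RETIRED bodies and no longer elaborate from source; the farm
  serves their pre-restate oleans, so an importer sees e.g. the constant
  `extinctionBuildsQCD_iff : ExtinctionBuildsQCD ↔ ∀ N_f ∈ {2,3}, SD(N_f) → QCDOf N_f` next to the NEW body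
  (for which that `Iff.rfl` fails).  Append-only forbids re-typing them in place; they are superseded by
  `WithoutTightPlusCollapse` (`…_sdPlus` names) and should be deleted/deprecated by a maintenance pass.
  Nothing in this work file uses them (it re-derives §0 locally); its imports of
  `WindowExtinction.Negative.SpectralFlow` / `…TipPricingStubCountMeasurable` are source-valid modulo the
  same stale chain.
* Dead ends (one line each): junk via tiny `Λ` / tiny `Z_m`-unit / huge `M₀` / tiny `η` (constants,
  (iv)); `L_k ≡ const` or `L_k = 0` (excluded by `tendsto_L`); doubler lines `m_crit ∈ [−8,−1]` (excluded by
  BRANCH; equally hard anyway); EXTINCT(b) vs TIGHT⁺ deterministic clash (no: with `c ≤ 1` the coercivity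
  collar only trims the inner `c a m_f/Z` of the window, §7b); THR internally refutable (8 audits + this
  one: no formal bug found in `IsQCDAlong`/`HasLatticeMassGap`/`OSData` clauses).
-/

section SDPlusAnalysis

variable {Nf : ℕ}

/-! ### §7a Load-bearing analysis of the new clauses -/

variable (Nf) in
/-- **The junk witness meets the volume cap** (R1) with `p = 2`: `canonicalAF` has `L_k = (k+1)² = a_k⁻²`. -/
theorem canonicalAF_cap : ∃ p : ℕ, ∀ᶠ k : ℕ in Filter.atTop,
    ((QCDRegularisation.canonicalAF Nf).L k : ℝ) ≤ ((QCDRegularisation.canonicalAF Nf).a k)⁻¹ ^ p :=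
  ⟨2, Filter.Eventually.of_forall fun k => by
    simp [QCDRegularisation.canonicalAF, QCDScheme.zeroAF, SpeciesScheme.zero]⟩

variable (Nf) in
/-- **The junk witness meets the branch clause**: `canonicalAF` has `m_crit ≡ 0 > −1`. -/
theorem canonicalAF_branch : ∀ᶠ k : ℕ in Filter.atTop, -1 < (QCDRegularisation.canonicalAF Nf).mcrit k :=
  Filter.Eventually.of_forall fun _ => by norm_num [QCDRegularisation.canonicalAF]

variable (Nf) in
/-- `SD⁺(N_f)` with TIGHT⁺ deleted (scalings, cap, branch and EXTINCT kept). -/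
def SDPlusWithoutTight : Prop :=
  ∃ reg : QCDRegularisation Nf, reg.HasMassScaling ∧ (reg.scheme 0 0 0).HasAsymptoticScaling ∧
    (∃ p : ℕ, ∀ᶠ k : ℕ in Filter.atTop, (reg.L k : ℝ) ≤ (reg.a k)⁻¹ ^ p) ∧
      (∀ᶠ k : ℕ in Filter.atTop, -1 < reg.mcrit k) ∧
        ∃ M₀ : ℝ, 0 ≤ M₀ ∧ ∃ c : ℝ, 0 < c ∧ ∀ m : Fin Nf → ℝ, (∀ f, M₀ < m f) → Extinct Nf reg c m

/-- The deletion is faithful. -/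
theorem sdPlusWithoutTight_of_sdPlus (h : SDPlus Nf) : SDPlusWithoutTight Nf := by
  obtain ⟨reg, h1, h2, hcap, hbr, M₀, hM₀, c, hc, h⟩ := h
  exact ⟨reg, h1, h2, hcap, hbr, M₀, hM₀, c, hc, fun m hm => (h m hm).1⟩

variable (Nf) in
/-- **Junk witness for SD⁺ minus TIGHT⁺**: `canonicalAF` (cap `p = 2`, branch, `M₀ = 0`, `c = 1`; the
defect integrand vanishes identically). -/
theorem sdPlusWithoutTight_canonicalAF : SDPlusWithoutTight Nf :=
  ⟨QCDRegularisation.canonicalAF Nf, QCDRegularisation.canonicalAF_hasMassScaling,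
    QCDScheme.zeroAF_hasAsymptoticScaling, canonicalAF_cap Nf, canonicalAF_branch Nf, 0, le_rfl, 1,
    one_pos, fun m hm => extinct_of_mcrit_nonneg _ (fun _ => le_rfl) le_rfl m hm⟩

/-- The restated crux with TIGHT⁺ deleted from its hypothesis. -/
def BridgePlusWithoutTight : Prop :=
  ∀ Nf : ℕ, (Nf = 2 ∨ Nf = 3) → SDPlusWithoutTight Nf → THR Nf

/-- **LOAD-BEARING (restated crux): without TIGHT⁺ the bridge IS its conclusion `THR 2 ∧ THR 3`.** -/
theorem bridgePlusWithoutTight_iff_thr : BridgePlusWithoutTight ↔ THR 2 ∧ THR 3 :=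
  ⟨fun h => ⟨h 2 (Or.inl rfl) (sdPlusWithoutTight_canonicalAF 2),
      h 3 (Or.inr rfl) (sdPlusWithoutTight_canonicalAF 3)⟩,
    fun hq Nf hNf _ => by
      rcases hNf with rfl | rfl
      exacts [hq.1, hq.2]⟩

/-- **Collapse schema (restated crux).** Replacing TIGHT⁺ by ANY side condition `P` met by `canonicalAF`
— on top of cap and branch — still yields a statement equivalent to `THR 2 ∧ THR 3`. -/
theorem bridgePlus_collapse_schema (P : ∀ Nf : ℕ, QCDRegularisation Nf → Prop)
    (hP : ∀ Nf, P Nf (QCDRegularisation.canonicalAF Nf)) :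
    (∀ Nf : ℕ, (Nf = 2 ∨ Nf = 3) →
      (∃ reg : QCDRegularisation Nf, P Nf reg ∧ reg.HasMassScaling ∧
        (reg.scheme 0 0 0).HasAsymptoticScaling ∧
          (∃ p : ℕ, ∀ᶠ k : ℕ in Filter.atTop, (reg.L k : ℝ) ≤ (reg.a k)⁻¹ ^ p) ∧
            (∀ᶠ k : ℕ in Filter.atTop, -1 < reg.mcrit k) ∧ ∃ M₀ : ℝ, 0 ≤ M₀ ∧ ∃ c : ℝ, 0 < c ∧
              ∀ m : Fin Nf → ℝ, (∀ f, M₀ < m f) → Extinct Nf reg c m) → THR Nf) ↔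
      THR 2 ∧ THR 3 := by
  have hw : ∀ Nf, ∃ reg : QCDRegularisation Nf, P Nf reg ∧ reg.HasMassScaling ∧
      (reg.scheme 0 0 0).HasAsymptoticScaling ∧
        (∃ p : ℕ, ∀ᶠ k : ℕ in Filter.atTop, (reg.L k : ℝ) ≤ (reg.a k)⁻¹ ^ p) ∧
          (∀ᶠ k : ℕ in Filter.atTop, -1 < reg.mcrit k) ∧ ∃ M₀ : ℝ, 0 ≤ M₀ ∧ ∃ c : ℝ, 0 < c ∧
            ∀ m : Fin Nf → ℝ, (∀ f, M₀ < m f) → Extinct Nf reg c m := fun Nf =>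
    ⟨QCDRegularisation.canonicalAF Nf, hP Nf, QCDRegularisation.canonicalAF_hasMassScaling,
      QCDScheme.zeroAF_hasAsymptoticScaling, canonicalAF_cap Nf, canonicalAF_branch Nf, 0, le_rfl, 1,
      one_pos, fun m hm => extinct_of_mcrit_nonneg _ (fun _ => le_rfl) le_rfl m hm⟩
  exact ⟨fun h => ⟨h 2 (Or.inl rfl) (hw 2), h 3 (Or.inr rfl) (hw 3)⟩,
    fun hq Nf hNf _ => by
      rcases hNf with rfl | rfl
      exacts [hq.1, hq.2]⟩

/-- **The line of an SD⁺ witness** (BRANCH + §3 pin): for every `M > M₀`, eventually in `k`,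
`−1 < m_crit(k)` and `−8 ≤ m_crit(k) − a_k M/Z_k ≤ 0`; in particular `m_crit(k) ∈ (−1, a_k M/Z_k]`. -/
theorem SDPlus.line_mem (h : SDPlus Nf) :
    ∃ reg : QCDRegularisation Nf, ∃ M₀ : ℝ, 0 ≤ M₀ ∧
      (∃ c : ℝ, 0 < c ∧ ∀ m : Fin Nf → ℝ, (∀ f, M₀ < m f) → Extinct Nf reg c m ∧ TightPlus Nf reg M₀ m) ∧
      ∀ M : ℝ, M₀ < M → ∀ᶠ k : ℕ in Filter.atTop, -1 < reg.mcrit k ∧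
        reg.mcrit k - reg.a k * M / reg.Zm k ∈ Set.Icc (-8 : ℝ) 0 ∧ reg.mcrit k ≤ reg.a k * M / reg.Zm k := by
  obtain ⟨reg, -, -, -, hbr, M₀, hM₀, c, hc, h⟩ := h
  refine ⟨reg, M₀, hM₀, ⟨c, hc, h⟩, fun M hM => ?_⟩
  have hT : Tight Nf reg M₀ (fun _ => M₀ + 1) := tight_of_tightPlus (h _ fun _ => by linarith).2
  filter_upwards [hbr, Tight.eventually_probe_mem reg M₀ (fun _ => M₀ + 1) hT hM] with k hk1 hk2
  exact ⟨hk1, hk2, by linarith [hk2.2]⟩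

/-- **TARGET NOTE for the lead (transfer stub).** `Lines/weyl_window.lean`'s `stub_cappedWitness` (≡ the other two
lines' `stub_honestWitness` / `stub_volumeCap`) is typed from the FILED hypothesis `Negative.SDHyp N_f` and is crux-sized as
typed (`Lines/TransferAudit_c4.md`: modulo `IndexSpreadBox` it is the capped sibling crux).  From the RESTATED hypothesis it is
a projection — retype its antecedent to SD⁺ and close it with this lemma (landed twin:
`Negative.ExtensivePin.cappedWitness_of_sdPlusHyp`). -/
theorem cappedWitness_of_sdPlus (h : SDPlus Nf) :
    ∃ (reg : QCDRegularisation Nf) (M₀ c : ℝ), 0 ≤ M₀ ∧ 0 < c ∧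
      reg.HasMassScaling ∧ (reg.scheme 0 0 0).HasAsymptoticScaling ∧
      (∀ m : Fin Nf → ℝ, (∀ f, M₀ < m f) → Extinct Nf reg c m ∧ Tight Nf reg M₀ m) ∧
      (∃ p : ℕ, ∀ᶠ k in atTop, (reg.L k : ℝ) ≤ (reg.a k)⁻¹ ^ p) ∧ (∀ᶠ k in atTop, -1 < reg.mcrit k) := by
  obtain ⟨reg, hms, has, hcap, hbr, M₀, hM₀, c, hc, h⟩ := h
  exact ⟨reg, M₀, c, hM₀, hc, hms, has, fun m hm => ⟨(h m hm).1, tight_of_tightPlus (h m hm).2⟩, hcap, hbr⟩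

/-! ### §7b The extensive two-sided pin: what TIGHT⁺ ∧ EXTINCT hand a bridge prover (theorems LANDED / drafted)

Landed in `Negative/TwoSidedPin.lean` (p136280): `windowRatio`/`bandRatio`/`shellRatio`,
`tightRatio ≤ {window,band,shell}Ratio + extinctRatio`, `eventually_{window,band,shell}Ratio_ge` (`≥ 1 − ε`), `seaShellPin`,
`SDHyp.two_sided_pin`.  Drafted (seat folder `drafts/…/Negative/ExtensivePin.lean`, to be proposed once the farm has built its
imports): `tightPlus_iff_tightRatio`, `eventually_{window,band,shell}Ratio_ge_floor` — for witness data EXTINCT ∧ TIGHT⁺ at a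
tuple above `M₀ ≥ 0` there is `η > 0` with, for every flavour `f`, `M > M₀`, `ε > 0`, eventually
`max 1 (η (a_k(2L_k+1))²) − ε ≤ windowRatio reg k (reg.L k) m f M` (resp. `bandRatio`, `shellRatio`) —, `tendsto_floor_atTop`
(`η (a_k(2L_k+1))² → ∞` for every regularisation), `SDPlusHyp.extensive_pin`, `cappedWitness_of_sdPlusHyp`.
MEANING: the restated hypothesis hands a bridge prover `≳ η √V_phys` near-zero modes of `H_W` AT THE FLAVOUR MASS in an
`a_k(m_f+M)/Z_k`-window (resp. as many real modes of `D_W(U,0,1)` in the band at the line, resp. in the unitary shell) — the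
Banks–Casher / Leutwyler–Smilga currency of TIGHT⁺ — while EXTINCT empties the inner collar and everything below `−m_f(k)`. -/

end SDPlusAnalysis

/-! ## §8 (2026-08-17, cdisprove seat g2, cycle 1) — LINE AUDIT of `block-away-the-sign` (skeleton v7) and
## what the g2 attacks add on the restated crux

Inputs read: route file rev 11 (crux text unchanged: `SD⁺ → THR`, stmt-18064), `PICKED.md` / `LEAD-c1` /
`Lines/block-away-the-sign-{c1,promote}.md`, the three ACTIVE registered stubs of skeleton v7 (signatures from
the item payload; the v7 file itself lives in the gate's evidence store), the landed supports E/P/W/F/Σ/Θ/Π/W1–W4,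
node `HeavyThresholdYMBridge.RobustYangMillsRG` rev 3 (stmt-17812) and its crux-attack verdict of 02:57Z.
NO KILL of the crux (kill shape unchanged, §0/§7d).  Findings, strongest first:

* §8a  STUB R (`stub_robustYangMillsRG : HeavyThresholdYMBridge.RobustYangMillsRG`, node stmt-17812 BY NAME) —
  THE NODE IS UNDER A `refuted-misstated` VERDICT (refuter-rattack-stmt-QuantumFields-17812-0, 2026-08-17T02:57Z,
  on paper, conditional; status flip to BLOCKED requested there): rev 3's conclusion is SUP-NORMED clustering
  `|E(G₁·G₂ᵗ) − E G₁·E G₂ᵗ| ≤ C·C₁·C₂·e^{−Δℓ₀t}` with `C` uniform in the torus `S ≥ L_k`, for the normalised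
  functional `E h = ∫ h w / ∫ w` of a weight `w` that `AdmAt` does NOT require to be non-negative, and whose
  format factor `F` (rough-region factor, `|F Z V| ≤ e^{c₀|Z|}`) may be SIGNED.  For any admissible member whose
  blocked density `ω = e^{−βₑA−W}·F(LF V,V)` changes sign with positive activity, AVERAGE-SIGN EXTENSIVITY kills
  the `t = 0`, `h = 2` instance for every `C`: with the `±1`-valued slab observable
  `G := ∏_{rough components in the slab} sign F`, `E(G) ≍ Z_slab^{|ω|}/Z_slab^{ω} = ⟨sign⟩_slab⁻¹ ≍ e^{+2ρ M³h} → ∞`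
  as `M → ∞` at fixed `k`, while `G² = 1` forces `|1 − E(G)²| ≤ C`.  CONSEQUENCES FOR THIS LINE.  (i) The line
  feeds R exactly a SIGNED weight — the honest all-antiperiodic sea weight `w = e^{−β S_W}·Re ∏_f det D_W^{AP}(m_f(k))`
  (Σ/Θ/Π landed its clauses 1–6).  Of the two repairs proposed on 17812, (a) "insert `∀ U, 0 ≤ w k S U` into
  `AdmAt`" makes `stub_robustYangMillsRG` USELESS for block-away-the-sign (its member is excluded syntactically,
  however well its sign is blocked away); (b) "OS-normed constants" keeps it.  (ii) LINE-COMPATIBLE REPAIR, for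
  both planners: FORMAT-LEVEL POSITIVITY `∀ Z V, 0 ≤ F Z V` (the BLOCKED density is a non-negative measure) —
  it kills average-sign extensivity (then `∫|ω| = ∫ω`, `|E h| ≤ sup|h|`), and it is verbatim the card's thesis
  "block away the sign" turned into the membership condition: the honest signed member is admissible iff G1
  holds WITH `F ≥ 0`.  (iii) TRUTH-VALUE TENSION INSIDE THE LINE AS TYPED: C′ ⊇ G1 asserts `AdmAt`-membership
  of the signed honest weight; if at some fixed (large) `k` its blocked `F` is negative with positive activity on
  large tori, then R (rev 3) is FALSE by the display above, and `ExtinctionBuildsQCD_of = T ∘ C′ ∘ R` derives THR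
  from a false named hypothesis — a vacuous line.  So the line's REAL core is not "G1 = format membership" but
  BLOCKED POSITIVITY: `∀ᶠ k, ∀ S ≥ L_k`, the `Bl`-push-forward of `e^{−β_k S_W} Re ∏_f det D_W^{AP}(U, m_f(k))` is a
  non-negative measure on coarse fields (conditional |det|-minority of sign-defective fine fields on EVERY fibre,
  rough ones included) — an R-independent, fixed-cutoff statement the planners can file and a disprover can
  attack (it is plausible for the honest witness: sign-defect carriers are smooth, the line is the edge of the
  dressed crossing distribution, early crossing is a tail event of the dressing on every fibre, §7c(iii); it is
  NOT implied by EXTINCT, which is an average over fibres).  Until 17812 is restated, `stub_robustYangMillsRG`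
  is `blocked-on: stmt-QuantumFields-17812` with repair risk (a) fatal / (a′ = ii) benign / (b) benign.

* §8b  STUB T (`stub_flavouredThreshold`) — THE BOUNDARY-CONDITION TRANSFER IS MIS-SCALED BY `Z_k` (quantified
  caveat on X2 "periodic from antiperiodic").  The landed spectral half of X2 (W `stub_indexAPSubPerLeWindow`:
  `|n₋(Γ₅D^{AP}) − n₋(Γ₅D^{per})| ≤ #{|λ| ≤ 8π/L}`; F `stub_apSignDefectForcesPerDefect`: AP sign defect ⇒ periodic
  sign-or-window defect PROVIDED `8π/L < c·w`, `w = a_k m_f/Z_k`) works at the BARE flavour scale, so at the scheme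
  torus it needs `8π/(2L_k+1) < c a_k m_f/Z_k`, i.e. (`bcThreshold_iff`, below)
  `ℓ_k := a_k(2L_k+1) > 8π Z_k/(c m_f)`.  SD⁺ forces ONLY `ℓ_k → ∞` (structure field `tendsto_L`) and
  `ℓ_k ≤ 2a_k^{1−p}+a_k` (CAP) — NOT `ℓ_k/Z_k → ∞`, while `Z_k ≍ (log a_k⁻²)^{γ₀/2β₀} → ∞` (`HasMassScaling`).
  Witnesses with `ℓ_k ≍ Z_k^{1/2}` meet every structural clause of SD⁺ (HMS, HAS, CAP with `p = 2`, BRANCH,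
  `tendsto_L`; e.g. `tipReg` with `L'_k = ⌈(k+1)·Z_k^{1/2}⌉`, and nothing in EXTINCT/TIGHT⁺ sees `ℓ_k/Z_k` either:
  TIGHT⁺'s floor `η ℓ_k²` is met by `√(χ_t V_phys) = √χ_t ℓ_k²` at any `ℓ_k ≫` correlation length), and for them
  F/W are VOID at `S = L_k` for every fixed `m_f` (the b.c. shift `8π a_k/ℓ_k` swamps the bare gap `a_k m_f/Z_k`).
  KERNEL-CHECKED AND LANDED: `Negative/VolumeFloor.lean` (p149644; `exists_slowVolume` — the tip family with
  `L_k = (k+1)⌈√Z_k⌉` meets HMS, HAS, CAP (`p = 26`), BRANCH and EXTINCT for all `c ≤ 1` while `Z_k/(a_k(2L_k+1)) → ∞`;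
  `exists_slowVolume_bcProviso_eventually_false` — on it `¬ (8π/(2L_k+1) < c·a_k m/Z_k)` eventually for EVERY
  `c, m > 0`): SD⁺ minus TIGHT⁺ does not supply the proviso, so a proof using F/W at `S = L_k` must get `ℓ_k/Z_k → ∞`
  from TIGHT⁺ or from an added clause.
  Physically the b.c. sensitivity of the low modes of `H_W(m_f(k))` is governed by the PHYSICAL quark correlation
  length (`e^{−m_phys ℓ}`, needs only `ℓ_k m_f → ∞`, which `tendsto_L` gives), not by the operator-norm Weyl shift
  against the bare scale `a m_f/Z_k = a m_R Z_P`: the Weyl route is lossy by exactly the factor `Z_k`.  REPAIRS: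
  (planner) add `Tendsto (fun k => reg.a k * reg.L k / reg.Zm k) atTop atTop` to the class — met by every
  polynomial-volume witness (`L_k = ⌈a_k^{-q}⌉`, `q ≥ 1`), physically harmless, and it makes E/P/W/F bite at the
  scheme torus for every `m_f > 0`; or (line) do X2 by massive-propagator locality at rate `a_k m_phys`.  The
  positivity hypothesis of T (periodic, `S = L_k`, from P ∘ E) is unaffected (P uses EXTINCT's first moment only).

* §8c  STUB C′ (`stub_seaCore'`) and JOINT SUFFICIENCY.  Hypotheses of C′ and T contain the FULL SD⁺ witness data
  (C′: HMS, HAS, CAP, BRANCH, EXTINCT ∧ TIGHT⁺ in `qcdPhaseQuenchedExpect` form; T: the same minus CAP, plus the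
  periodic positivity and the core package) — no instantiation is possible without an SD⁺ witness (§7c: none in
  sight), so neither stub is refutable now; both are implication-shaped with YM-grade consequents (gluonic OS data
  `T : OSData (YMSpecies SU3) 4`, non-trivial, non-Gaussian, gapped, with lattice clustering at rate `Δ a_k n` on
  ALL tori `S ≥ L_k` under the SIGNED honest functional).  Typing audit (clause by clause, from the registered
  signatures): the honest functional `E k S h = ∫ h·Re∏det D^{AP} dμ_W / ∫ Re∏det D^{AP} dμ_W` is a genuine
  normalised signed expectation for `m_f(k) > −1` (Π: Lüscher positivity of the all-AP partition function on odd
  tori, landed p141689; BRANCH gives `m_f(k) > −1` eventually), so no `x/0` junk; `∀ ψ ∃ φ ∀ E (E = …) → ∃ cY mY T Δ`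
  is the intended hereditary shape (renormalisations and `T` may depend on the subsequence); the convergence
  clause pins `T.schwinger` on off-diagonal tensor tests only, junk `cY ≡ 0` is guarded by
  `T.IsNontrivial/IsNonGaussian curvature` (G5); the clustering clause is over all `k` eventually and all
  `S ≥ L_k`, `n ≤ S` (half torus), sup-normed with `C` per pair `(A, B)` — NOTE it inherits §8a's sup-norm issue
  only if the honest functional's `|E h| ≤ C sup|h|` fails, i.e. again iff blocked/fine sign cancellation is
  extensive: for the honest member `|E_{k,S} h| ≤ sup|h| / ⟨sign⟩^{AP}_{k,S}` and `⟨sign⟩_{k,S} → ?` as `S → ∞` AT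
  FIXED `k` is NOT controlled by EXTINCT (first moment `≤ ε (S/L_k)⁴`, useless for `S ≫ L_k ε^{-1/4}`): if sign
  defects have positive density `ρ_k` per site at fixed `k` (they do at any finite `β_k`: open sets of fields),
  `⟨sign⟩_{k,S} ≍ e^{−2ρ_k(2S+1)⁴} → 0` and the clustering constant `C(A,B)` of C′'s LAST conjunct cannot be uniform
  in `S` unless truncation cancels the normalisation exactly (it does for a convergent polymer expansion of the
  signed measure — which is then the content).  So C′'s last conjunct is fine in truth-value only via a genuine
  signed cluster expansion on all large tori at fixed `k` (the δ-stub of the old weyl-window line in new clothes),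
  not via EXTINCT.  T ∘ C′ ∘ (E, P) matches THR syntactically (`reg'` with `a, β, L, Z_m` along `φ`, free `m_crit`,
  own threshold `M₂`); no gap is smuggled at the glue level (v7 rc 0, 3 sorries) — the gaps are INSIDE C′ (G1 =
  blocked positivity + format, G3–G6) and T (X2 mis-scaled as above, X3–X5).

* §8d  CRUX LEVEL (restated SD⁺ → THR): nothing new is killable.  Two remarks for the planner.  (1) CAP LOOKS
  REDUNDANT NEXT TO TIGHT⁺ (heuristic, CLT + Lifshitz): on the free-volume tip family at fixed `k` and torus side
  `N`, `E₊|index| ≈ √(2/π)·√ρ_k·N²` (independent ± carriers of site density `ρ_k`) against the floor `η a_k² N²` —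
  the ratio `0.8 √ρ_k/(η a_k²)` is `N`-INDEPENDENT, so extra volume buys nothing for TIGHT⁺ (it only helped the
  filed floor `1`), and `ρ_k ≪ a_k⁴` (Lifshitz tail of tip modes) fails it cap or no cap.  R1 is belt-and-braces
  next to R2; harmless, but no stub should expect to CONSUME the cap (C′ lists it, T does not).  (2) The
  extensive pin is now a theorem on the healthy import chain: `Negative/ExtensivePin.lean` (LANDED p148475, this seat):
  `tendsto_tightFloor_atTop` (floor `→ ∞` for EVERY regularisation), `tightRatio_le_mean_add_extinctRatio`
  (pointwise budget ⇒ ratio budget), `eventually_floor_le_{window,band,shell}Mean` (EXTINCT ∧ TIGHT⁺ ⇒ the three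
  phase-quenched means `≥ max 1 (η(a_k(2L_k+1))²) − ε` eventually on the scheme torus),
  `eventually_le_{window,band,shell}Mean` (they exceed every constant), `windowExtinction_extensive_pin`
  (reading for the sibling crux, with `c ≤ 1`).  This is the currency T's X3 (flavoured sector) must consume.

* §8e  INTEGRITY (operator): `Negative/{ThresholdCollapse, WithoutTightPlusCollapse, TwoSidedPin}` are ACCEPTED
  (p135995, p136280) but UNBUILT on the farm (`lean check` on any importer: rc 75
  `remote:stale:N:unbuilt:…`), because the root `Negative/WithoutTightCollapse` no longer elaborates from source
  (§7e) and the snapshot cannot be rebuilt through it; every older `Negative/*` is served from pre-restate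
  oleans.  New negative lemmas must therefore hang off `Negative/CoercivityCeiling` (as `ExtensivePin` does, in
  the sub-namespace `…Negative.ExtensivePin` to avoid the accepted-but-unbuilt names); the gate's `dedup.landed`
  nevertheless treats `TwoSidedPin`'s declarations as importable — a proposal may neither import nor restate
  them.  Maintenance recipe: evidence `MAINTENANCE-stale-negative-chain.md` (01:40Z) on this item.

* Dead ends this cycle (one line each): junk member of R rev 3 à la rev 2 (Haar + wild `Bl`) — excluded by the
  coercivity conjunct `cA·S_W ≤ A − A(1)` with `β₀` chosen after `B₀, cA` (no `W = −βₑA` cancellation), too-cold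
  fine weights excluded by `βₑ → β_l < ∞` + `A₀`; refuting C′/T by instantiation — needs an SD⁺ witness; a
  configuration-wise clash between the AP functional and periodic EXTINCT — none (W/F are the exact relation);
  CAP-redundancy as a theorem — needs the Lifshitz upper bound (not provable now); refuting SD⁺ (sibling) by a crude
  DLR small-ball LOWER bound on the sub-line defect density — a smooth patch of lattice size `R` carries a real mode at
  depth `≍ C/R²`, sub-line needs `R² ≳ Cβ_k/0.87`, so the bound is `e^{−cβ_k R⁴} = e^{−c′β_k³}` per site against
  `(2L_k+1)⁴ ≤ e^{pβ_k/b₀}`: consistent with EXTINCT under every polynomial cap (no refutation, confirms §7c(ii)).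
-/

section LineAudit

/-- **§8b, the b.c.-transfer threshold in closed form.** For `Z > 0`, torus side `N > 0` and any `a, c, m`:
F's proviso `8π/N < c·(a m/Z)` is exactly `8π Z < c m (a N)` — a LOWER bound on the physical torus size
`ℓ = aN` in units of `Z/m`, which no clause of SD⁺ supplies (`tendsto_L` gives `ℓ → ∞` only, CAP bounds `ℓ` above,
`HasMassScaling` sends `Z → ∞`). -/
theorem bcThreshold_iff {a Z c m N : ℝ} (hZ : 0 < Z) (hN : 0 < N) :
    8 * Real.pi / N < c * (a * m / Z) ↔ 8 * Real.pi * Z < c * m * (a * N) := by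
  have e : c * (a * m / Z) * N = c * m * (a * N) / Z := by
    field_simp
  rw [div_lt_iff₀ hN, e, lt_div_iff₀ hZ]

/-- **§8b, the structural clauses do not bound `ℓ_k/Z_k` below** (schematic form, any sequences): if
`ℓ_k/Z_k → 0⁺` then for every fixed `c, m > 0` the proviso `8π Z_k < c m ℓ_k` fails eventually — F and W are void
at the scheme torus for such a witness, whatever threshold `M₁` the line picks. -/
theorem bcThreshold_eventually_false {ℓ Z : ℕ → ℝ} (hZ : ∀ k, 0 < Z k)
    (h : Tendsto (fun k => ℓ k / Z k) atTop (𝓝 0)) {c m : ℝ} (hc : 0 < c) (hm : 0 < m) :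
    ∀ᶠ k in atTop, ¬ 8 * Real.pi * Z k < c * m * ℓ k := by
  have hpos : 0 < 8 * Real.pi / (c * m) := by positivity
  filter_upwards [(tendsto_order.1 h).2 _ hpos] with k hk
  rw [not_lt]
  -- `ℓ_k < (8π/(cm)) Z_k`, i.e. `c m ℓ_k < 8π Z_k`
  have h1 : ℓ k < 8 * Real.pi / (c * m) * Z k := (div_lt_iff₀ (hZ k)).1 hk
  have h2 : c * m * ℓ k < c * m * (8 * Real.pi / (c * m) * Z k) :=
    mul_lt_mul_of_pos_left h1 (by positivity)
  have e : c * m * (8 * Real.pi / (c * m) * Z k) = 8 * Real.pi * Z k := by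
    field_simp
  rw [e] at h2
  exact h2.le

end LineAudit

/-! ## §9 (2026-08-17, cdisprove seat g3, cycle 2) — NO KILL TO FILE; the lead's blocked-positivity target;
## the format's free constant; line audit of skeleton v13

Inputs read: route file (crux text unchanged: `SD⁺ → THR`), skeleton v12/v13 (`Lines/block_away_the_sign.lean`, lead c2:
stubs R `RobustYangMillsRGPosNode`, G1 `stub_seaBlockFormat` → `BlockFormatPosAt … (seaWeightAP reg m) βe Bl k S`, G36, T),
`PICKED.md`, the lead's NOTES/HANDOFF (`disprover-wanted: blocked positivity`), the node item stmt-17812 (still OPEN; its own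
line `birth` has a `BlockedLawNonneg`-type stub and a landed certificate p149100 that the SIGNED-`F` ball format fails at `t = 0`),
`Literature/…/QuasiLocalGaugePerturbation.lean` (the format vocabulary).

* §9o  STATUS OF THE "FILE THE REFUTATION" INSTRUCTION.  There is no kill of this crux in this file or anywhere: §0/§7d/§8
  record `¬ ExtinctionBuildsQCD ↔ ∃ N_f ∈ {2,3}, SD⁺(N_f) ∧ ¬THR(N_f)` (`not_extinctionBuildsQCD_iff`) and `¬THR` ("no massive
  QCD above any threshold along any mass-scaling regularisation") is summit-hard.  The g2 DONE line was truncated by the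
  harness mid-sentence at "node under refuted-misstated verdict" — that verdict (rattack-17812, 2026-08-17T02:57Z, on paper)
  concerns the NODE `RobustYangMillsRG` rev 3 (stmt-17812), whose positive-format restriction is this line's Stub R; it is
  not a refutation of `ExtinctionBuildsQCD`, and nothing here can be "turned into a landed `¬S`".

* §9a  A NEW ATTACK ON G1 AND WHY IT IS VOID (kernel-checked, LANDING `Negative/FormatFreeConstant.lean`, p152146).  G1 must put
  the UNNORMALISED weight `w_{k,S} = e^{−β_k S_W}·Re∏det D^{AP}` into the format `ρ = e^{−βe A − W}·F(LF V, V)` whose exponents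
  have `k,S`-uniform weighted norms PER COARSE SITE, while `log ∫ w_{k,S} dU = Θ((2S+1)⁴) = Θ(b_k⁴)` per coarse site with
  `b_k = ℓ₀/a_k → ∞` (gauge free energy `≍ 4 log β_k` plus `12 N_f ⟨log|λ|⟩` per fine site) — a total-mass mismatch that would
  make G1's conclusion unsatisfiable for EVERY regularisation (hence G1 ⟺ "SD⁺ uninhabited", a vacuous line).  IT FAILS:
  `polymers b = (blockCorners b).powerset ∋ ∅`, the activity `act ∅` is a constant (it depends on `polymerEdges b ∅ = ∅`), and
  NEITHER `NormLE` NOR `HasAnalyticNormLE` sees it (their weighted sums run over `polymersThrough b y = {X ∋ y}`), nor does the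
  support-diameter clause (vacuous at `X = ∅`) or coercivity (`A.total V − A.total 1`).  `FormatFreeConstant.constShift W c`
  shifts that constant; `total_constShift`, `normLE_constShift_iff`, `hasAnalyticNormLE_constShift_iff`,
  `supportClause_constShift_iff`, `integral_identity_smul`, and `posFormatClause_smul : 0 < c → PosFormatClause … w βek Bl →
  PosFormatClause … (c·w) βek Bl` for the VERBATIM `∃ (A W F)` tail of `BlockFormatPosAt` (coarse side generalised).  READING:
  normalisation is NOT load-bearing — membership of `w_{k,S}` and of `w_{k,S}/∫w_{k,S}` are equivalent `k` by `k`, `S` by `S`;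
  no bound on a partition function refutes G1 or the node; what the format constrains is the SHAPE of `log ρ` on small coarse
  fields and its size on rough ones.  (Dead end recorded so that no later seat repeats it.)

* §9b  THE LEAD'S TARGET — BLOCKED POSITIVITY ("can a coarse field `V`, under any `5b_k`-local covariant blocking, force a
  |det|-MAJORITY of sign-defective fine fields in its fibre at fixed `k` on large tori, `N_f = 3` / split `N_f = 2`?").
  ANSWER (heuristic, mechanism-level; no theorem either way is within reach): NO — but "minority" is the wrong currency on
  large tori, and what G1 must really prove there is PARITY FACTORISATION.  In detail:
  (1) WHAT A SIGN DEFECT IS.  `det D_W^{AP}(U, m_f(k)) < 0` iff an odd number of real eigenvalues of the massless operator lie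
      in `[0, τ_f)`, `τ_f := −m_f(k) = |m_crit(k)| − a_k m_f/Z_k` (all real eigenvalues are `≥ 0`: §1 `re_mem_Icc_of_real_root`,
      the LANDED configuration-wise fact this verdict leans on; F/W transfer AP ↔ periodic).  EXTINCT + TIGHT⁺ locate the line:
      large smooth (dressed) instantons cross at the critical mass `|m_c(β_k)|` sharply, EXTINCT forbids them below `τ_f` for every
      `m_f > M₀` and TIGHT⁺ needs them below the probe `|m_crit| + aM/Z` for every `M > M₀`, so `||m_crit(k)| − |m_c(β_k)|| ≲ a_k M₀/Z_k`
      and `τ_f ≤ |m_c| − a_k(m_f − M₀)/Z_k`: a defect is a mode crossing EARLIER than the critical mass by the margin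
      `μ_f := a_k(m_f − M₀)/Z_k > 0`.
  (2) WHAT A COARSE FIELD CAN FORCE.  A real mode of `D_W(U,0,1)` carried by a structure of lattice size `ϱ` sits at
      `λ ≈ λ_tree(smooth part of U) + |m_c^{loc}| + ξ`, with `λ_tree ≥ 0` ALWAYS (§1), `λ_tree ≍ c₁/ϱ²` for a smooth lump, and `ξ` the
      fluctuation of the UV dressing averaged over the mode's support, `σ(ϱ) ≍ c₂ g²/ϱ²`.  Early crossing needs
      `ξ < −(λ_tree + μ_f + |m_c^{loc}| − |m_c|)`: ALWAYS a downward fluctuation of the dressing, by `≥ c₁/ϱ²` for small lumps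
      (probability `≤ e^{−C β_k²}`, `C = c₁²/(2c₂²)·(β/g²)`-scaling — the "early crossers `e^{−cβ²}`" of the rattack note) and by
      `≥ μ_f ≫ σ(ϱ)` for lumps with `ϱ ≳ ϱ** := (c₂ g² Z_k/(a_k m))^{1/2}` (probability `≤ e^{−(ϱ/ϱ**)⁴/2}`).  A `5b_k`-local blocking
      sees the fine field only through `O(1)` functionals per block of `b_k⁴` links: it controls the SMOOTH content at scales
      `≥ b_k` completely and the plaquette-scale dressing only to `O(b_k^{−4})` (equivalence of ensembles), and
      `b_k^{−4} = (a_k/ℓ₀)⁴ ≪ μ_f`; moreover `ϱ**/b_k = (c₂ g² Z_k a_k/m)^{1/2}/ℓ₀ → 0`, so every structure `V` CAN force is in the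
      super-exponential regime, and every structure in the `e^{−Cβ²}` regime is invisible to `V`.  A rough `V` (coarse plaquettes
      far from `1`) forces curvature `θ/b_k²` per fine plaquette, realised by smooth interpolations at action `O(β_k θ²)` per rough
      coarse plaquette (Bianchi forbids isolated single-plaquette dislocations; tubes/sheets cost the same order) — it heats
      nothing at scale `a_k` and cannot LOWER the local dressing `|m_c^{loc}|` (a hotter block raises it: deeper crossings, fewer
      defects).  Hence for EVERY `V` and every carrier location `x`, `q_x(V) := P(early crosser at x | Bl U = V) ≤ q̄_k :=
      max(e^{−Cβ_k²}, e^{−(b_k/ϱ**)⁴/2}) ≪ ½`.  Split `N_f = 2`: the defect is a mode in the WINDOW `[τ₂, τ₁)` — smaller still.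
  (3) WHY "MAJORITY" NEVER HAPPENS BUT "MINORITY WITH MARGIN" FAILS ANYWAY.  With conditionally (quasi-)independent carriers,
      `P(sign-defective | V) = (1 − ∏_x(1 − 2q_x(V)))/2 < ½` for every `V` — never a majority — but `→ ½` as `S → ∞` at fixed `k`
      (`Σ_x q_x ≍ ρ_k(2S+1)⁴ → ∞`, `ρ_k > 0` the defect density per site at fixed `k`: open sets of fields), and
      `P(some defect | V) → 1`.  So the first-moment (Markov) route of the card — `∫_fibre w ≥ (1 − 2·P(defect | V))·∫_fibre |w|`,
      `integral_signed_ge_of_defectFraction` — certifies fibre positivity ONLY on conditioning regions of fine volume `≪ 1/ρ_k`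
      (EXTINCT's bound `ε((2S+1)/(2L_k+1))⁴` gives it at the scheme torus and up to `S ≲ L_k ε^{−1/4}`), whereas the format, hence
      G1, needs `ρ(V) ≥ 0` for ALL `S ≥ L_k` (the node's uniformity in `S` is its thermodynamic content and cannot be cut by the
      line).  There positivity is TRUE only as PARITY FACTORISATION: `E[sign | V] = ∏_x (1 − 2q_x(V))·(1 + cluster corrections)
      ≈ exp(−2Σ_x q_x(V)) > 0` — super-exponentially SMALL in the volume, its logarithm an extensive constant (absorbed by the free
      constant of §9a) plus a quasi-local functional of `V` of norm `O(ρ_k b_k⁴) → 0` (joins `W`).  The corrections are a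
      LOW-ACTIVITY (Mayer) expansion of the signed defect gas in the |w|-measure conditioned on `V`: activity `ρ_k`; given `V`
      the constrained fluctuation field is GAPPED at scale `ℓ₀` (the averaging constraint — the mechanism of every Bałaban step),
      so distant carriers decorrelate exponentially in units of `b_k` and the expansion needs NO fine mass gap; but it IS a
      convergent expansion for a signed measure on every fibre, rough ones included — in RG language: the card's minority schema
      must be applied INSIDE the fluctuation cluster expansion, per localisation domain (fine volume `≍ |X| b_k⁴ ≪ 1/ρ_k` ✓), never
      to a whole fibre; the δ-stub of the old weyl-window line in its final clothes (§8c said the same of C′'s last conjunct).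
      (Consistent lore, cited from memory — literature search degraded this session: the `N_f = 1` Wilson simulations monitor
      negative-determinant configurations through the lowest real eigenvalues and find them rare but present near `κ_c` at fixed
      `β` — Farchioni et al. 2007, DeGrand et al. 2006.)
  (4) VERDICT FOR THE LEAD.  Blocked positivity is not where G1 dies: no `Bl`-fibre over any `V` is defect-dominated, for
      averaging-type covariant blockings (thin/decimated blockings fail the FORMAT, not positivity — lead's census: `A^thin ≍
      S_W/b_k`).  But G1's positivity content is mis-described as "minority with margin ½ on fibres": it is (local minority on
      regions of volume `≪ 1/ρ_k`) ∧ (factorisation of the conditioned fine measure across such regions) — i.e. exactly one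
      Bałaban-type fluctuation step WITH a signed small-activity sector.  No theorem in print; not refutable here either (needs an
      SD⁺ witness even to instantiate, §7c).  The kernel-checked skeleton of (3) is below (`parity_*`, `markov_margin_fails`).
  (5) A TOY ONE COULD RUN (not run: it cannot reach the asymptotic regime `b_k → ∞` that carries the argument, and block-sum
      conditioning of i.i.d. plaquette variables provably leaves within-block fluctuations free): quenched 2d U(1), fine `32²`,
      blocks `8²`, conditional law of the lowest real eigenvalue of the Wilson operator given block data `V`, for typical /
      forced-charge / rough `V`; expected outcome `P(λ_min < |m_c| − μ | V) ≈` unconditional tail for all three.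

* §9c  LINE AUDIT OF v13 (delta to §8).  (i) G1 now concludes `BlockFormatPosAt` (block clauses only; fine clauses 1–7 assembled
  from the landed Σ/Θ/Π in `fineClausesAt_seaWeightAP`) — correct narrowing, nothing smuggled: `admissiblePosAt_of` repacks.
  (ii) The identity clause forces ABSOLUTE CONTINUITY of `Bl_*(w dU)` w.r.t. Haar on the coarse torus: any blocking whose image
  is Haar-null for some `U`-set of positive `w`-mass (values in a proper subvariety, non-submersive averaging-then-projection at
  degenerate points) fails it for trivial reasons — the prover's `Bl` must be a.e. submersive (decimation is; Bałaban's
  averaging with unitary projection is, off a null set).  (iii) Normalisation: immaterial (§9a).  (iv) R = `RobustYangMillsRGPosNode`: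
  junk-member hunt extended — `F(Z,V) := [Z = ∅]` (hard small-field constraint) and quasi-local `F` coupling to winding loops
  through wrapping rough tubes are LEGAL rough factors (all `F`-clauses hold) but give no non-clustering member (universality /
  Peierls suppression `e^{−(β₀ cA ε − c₀)|Z|}` with `β₀` chosen after `c₀`); abelianised (Cartan-torus) weights cannot stay
  abelian under bounded format norms (non-abelian excitations re-enter at cost `≤ e^{βl A₀}` per coarse plaquette, confinement at
  an astronomically large but finite scale, `∃Δ > 0` member-dependent); product/independent junk clusters trivially.  No kill.
  (v) T, G36: implication-shaped over SD⁺-witness data — uninstantiable (§7c), unchanged.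

* Dead ends this cycle (one line each): total-mass / free-energy mismatch against the format (void: free constant `act ∅`, §9a);
  forcing early crossers by rough or instanton-like coarse fields (tree-level real spectrum `≥ 0` + uncontrollable dressing, §9b(2));
  hard-core / winding rough factors and abelianised weights as junk members of the positive node (§9c(iv)); DLR finite-energy
  mismatch at the coarse scale (needs a large-deviation LOWER bound on fibre free-energy differences `≍ β_k θ²`, harder than the
  format theorem itself).
-/

section BlockedParity

variable {ι : Type*} [Fintype ι]

/-- **§9b(3), the parity identity of independent carriers.**  If carrier `i` is defective with probability `q i`,
independently, the expected sign `E[(−1)^N] = Σ_ω ∏_i P(ω_i)·(−1)^{ω_i}` equals `∏_i (1 − 2 q_i)`. -/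
theorem parity_expectation_eq_prod [DecidableEq ι] (q : ι → ℝ) :
    ∑ ω : ι → Bool, ∏ i, (if ω i then -(q i) else 1 - q i) = ∏ i, (1 - 2 * q i) := by
  have h : ∀ i, (∑ b : Bool, (if b then -(q i) else 1 - q i)) = 1 - 2 * q i := fun i => by
    rw [Fintype.sum_bool]
    simp only [if_true, Bool.false_eq_true, if_false]
    ring
  rw [← Finset.prod_congr rfl fun i _ => h i, Finset.prod_univ_sum, Fintype.piFinset_univ]

/-- **No forced carrier ⇒ the fibre sign is non-negative** (every `q_i ≤ ½`). -/
theorem parity_nonneg_of_le_half {q : ι → ℝ} (h : ∀ i, q i ≤ 1 / 2) : 0 ≤ ∏ i, (1 - 2 * q i) :=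
  Finset.prod_nonneg fun i _ => by linarith [h i]

/-- **… and positive when every `q_i < ½`** — however many carriers there are (positivity WITHOUT minority). -/
theorem parity_pos_of_lt_half {q : ι → ℝ} (h : ∀ i, q i < 1 / 2) : 0 < ∏ i, (1 - 2 * q i) :=
  Finset.prod_pos fun i _ => by linarith [h i]

/-- **One forced carrier flips the fibre**: if a single carrier is defective with probability `> ½` and all others with
probability `< ½`, the expected sign is NEGATIVE — the shape a kill of blocked positivity would have to take (§9b(2): it
needs a coarse-forceable structure with tree-level real eigenvalue below `τ_f − |m_c| < 0`, excluded by §1). -/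
theorem parity_neg_of_one_forced [DecidableEq ι] {q : ι → ℝ} {j : ι} (hj : 1 / 2 < q j)
    (h : ∀ i, i ≠ j → q i < 1 / 2) : ∏ i, (1 - 2 * q i) < 0 := by
  rw [← Finset.mul_prod_erase Finset.univ (fun i => 1 - 2 * q i) (Finset.mem_univ j)]
  exact mul_neg_of_neg_of_pos (by linarith)
    (Finset.prod_pos fun i hi => by have := h i (Finset.ne_of_mem_erase hi); linarith)

/-- **§9b(3), minority is the wrong currency on large tori.**  For any fixed per-carrier defect probability `q ∈ (0, ½)`
there is a number of carriers `N` (i.e. a torus size) at which the first-moment margin `1 − 2·E[#defects] = 1 − 2Nq` is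
NEGATIVE (the Markov route `∫_fibre w ≥ (1 − 2 P(defect))∫|w|` is void) while the true expected sign `(1 − 2q)^N` is still
POSITIVE (parity factorisation). -/
theorem markov_margin_fails {q : ℝ} (hq : 0 < q) (hq' : q < 1 / 2) :
    ∃ N : ℕ, 1 - 2 * (N * q) < 0 ∧ 0 < (1 - 2 * q) ^ N := by
  obtain ⟨N, hN⟩ := exists_nat_gt (1 / q)
  refine ⟨N, ?_, pow_pos (by linarith) N⟩
  have h1 : 1 < N * q := by
    have := (div_lt_iff₀ hq).1 hN
    linarith
  linarith

/-- The probability of an ODD number of defects among independent carriers, `(1 − ∏(1 − 2q_i))/2`, is `< ½` whenever every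
`q_i < ½`: a |det|-MAJORITY of sign-defective fine fields is never forced in the independent-carrier model (§9b(3)). -/
theorem oddProb_lt_half {q : ι → ℝ} (h : ∀ i, q i < 1 / 2) : (1 - ∏ i, (1 - 2 * q i)) / 2 < 1 / 2 := by
  have := parity_pos_of_lt_half h
  linarith

end BlockedParity


/-! ## §10 (2026-08-17, cdisprove seat g4, cycle 3) — STATUS (no `¬S` exists; the re-seat loop), the hand-back's
## GROWTH clause certified both ways (LANDED `Negative/VolumeGrowth.lean`, p154859, commit 7d5e387d4790), line v14 audit delta

Inputs read: route file (crux text unchanged: `SD⁺ → THR`, probe rc 0), `PICKED.md` (lead c3), `Lines/block-away-the-sign-c3.md`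
(lead c3 cycle report = HAND-BACK `promote-stub`, recommendations (a)–(d)), the item's evidence list (46 entries, last
`LEAD-c3.md` 10:14Z), `Negative/*` build state (probe: `VolumeLever`/`TightPinsLine` chains BUILT; `WithoutTightPlusCollapse`,
`ExtensivePin`, `VolumeFloor`, `FormatFreeConstant` ACCEPTED BUT UNBUILT — `remote:stale:83:unbuilt` — so new lemmas still hang
off `VolumeLever`/`CoercivityCeiling`, §8e).

* §10o STATUS / HARNESS NOTE.  This seat was armed a second time with task `file-refutation` ("turn the Disproof.lean kill
  into a landed `¬S`").  There is no such kill and none is claimed anywhere in this file: the kill shape is unchanged since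
  §0 — `¬ ExtinctionBuildsQCD ↔ ∃ N_f ∈ {2,3}, SD⁺(N_f) ∧ ¬THR(N_f)` (`not_extinctionBuildsQCD_iff`) — and BOTH conjuncts are
  out of reach (SD⁺ has no constructible witness, §7c; `¬THR` is the negation of the threshold form of the summit conjunct,
  §7d).  CAUSE OF THE LOOP: the priority layer keys this re-seat on the refuter DONE grammar's CLASS TOKENS occurring in the
  previous DONE line; g2's line carried one while quoting the 02:57Z verdict on the NODE stmt-17812, and g3's line repeated the
  token while explaining g2's.  RULE for every later disprover seat on this crux: a `no kill` DONE line must not contain those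
  class tokens at all — write "the 17812 node verdict" — and must keep the `ok: cdisprove … — no kill (…)` shape.
* §10a THE GROWTH CLAUSE, CERTIFIED BOTH WAYS (kernel-checked; LANDED `Negative/VolumeGrowth.lean`, p154859 ACCEPTED 10:34Z, namespace
  `…Negative.VolumeGrowth`, imports only the built `Negative.VolumeLever`).  The hand-back §3(c) adopts §8b's repair: add
  `GROWTH : Tendsto (fun k => reg.a k * reg.L k / reg.Zm k) atTop atTop` to the SD⁺ class (18063/18064 jointly).
  (i) SUFFICIENT: `VolumeGrowth.bcProviso_eventually_of_growth` — along ANY regularisation with GROWTH, for every constant `C₀`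
  (F's `8π`), every `c > 0` and every `m > 0`, eventually `C₀/(2L_k+1) < c·(a_k m/Z_k)`; so F (`stub_apSignDefectForcesPerDefect`)
  and W (`stub_indexAPSubPerLeWindow`) bite at the scheme torus for EVERY flavour mass, with no extra threshold.
  (ii) SAFE BUT NOT JUNK-EXCLUDING: `VolumeGrowth.tendsto_canonicalAF_growth` (local copy `canonicalAF_growth` below) — the junk
  witness `canonicalAF` (`L_k = a_k⁻²`, line at bare mass `0`) has `a_k L_k/Z_k = (k+1)/(log (k+1)²)^{γ₀/2β₀} → ∞`
  (`(log x)^γ = o(x^{1/2})`, no hypothesis on `N_f`) and meets HMS, HAS, CAP (`p = 2`), BRANCH and EXTINCT for all `c ≤ 1`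
  (`VolumeGrowth.sdPlusGrowthWithoutTight_canonicalAF`); hence `VolumeGrowth.bridge_growthWithoutTight_iff Q :
  (∀ N_f ∈ {2,3}, SD⁺[TIGHT⁺ ↦ GROWTH](N_f) → Q N_f) ↔ Q 2 ∧ Q 3` for EVERY conclusion family `Q`, and, with `Q = THR`,
  `bridgePlusGrowthWithoutTight_iff_thr` below (via §7a's `bridgePlus_collapse_schema`).  READING FOR THE PLANNER: adding GROWTH
  changes nothing in the load-bearing analysis — TIGHT⁺ stays the ONLY junk-excluding clause, every landed `Negative/*` collapse
  persists verbatim —, CAP ∧ GROWTH are jointly consistent (same witness: `ℓ_k = a_k(2L_k+1) ≍ a_k⁻¹` sits between `ω(Z_k)` and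
  `O(a_k^{1−p})`), and `Negative/VolumeFloor` (p149644) is the matching independence result (SD⁺ ∖ TIGHT⁺ ⊬ GROWTH).  Heuristically
  TIGHT⁺ does not give GROWTH either (§8b: its floor is the Leutwyler–Smilga `√(χ_t V_phys)`, blind to `ℓ_k/Z_k`), so the clause is
  a genuine and harmless addition — the cheapest of the hand-back's four recommendations, and the only one a disprover can certify now.
* §10b LINE AUDIT DELTA (skeleton v14).  Lead c3 re-registered v13 as v14 (header-only change; 4 sorries = R `stub_robustYangMillsRG`,
  G1 `stub_seaBlockFormat`, G36 `stub_coreOfBlockGap`, T `stub_flavouredThreshold`) and HANDED THE CRUX BACK (`promote-stub`):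
  nothing new to attack — R is item 17812's positive-format restriction (blocked on that item's repair), G1/G36/T are
  implication-shaped over SD⁺-witness data and uninstantiable (§7c, §8c, §9c); joint sufficiency unchanged (`ExtinctionBuildsQCD_of`
  by name, rc 0).  The c3 Domination certificate (`extinctionBuildsQCD_of_thresholdQCD`, `…_of_robustYangMillsRG`,
  `…_iff_thresholdQCD` given `WindowExtinction`; item evidence `Domination.lean`) is the by-name form of §0's sandwich
  (`extinctionBuildsQCD_of_thr`, `extinctionBuildsQCD_iff_thr_of_windowExtinction`) — consistent, positive, not attackable.
  No `-- Targets`: payload `stuck_stubs` / `targets` empty.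
* §10c WHAT WOULD RE-ARM A DISPROVER USEFULLY (for the planners' restatement).  (1) SD⁺ restated with GROWTH — §7a's schema re-run in
  advance (§10a: no new junk, no new exclusion).  (2) G1 promoted as a stand-alone item "SD⁺-witness ⇒ `BlockFormatPosAt` membership of
  the honest signed AP sea weight": attackable only on its FORMAT side (junk `Bl`, the a.e.-submersion forced by the identity clause
  §9c(ii), the free constant §9a) until an SD⁺ witness exists; its positivity content is parity factorisation (§9b), not refutable here.
  (3) G36 promoted / shared with 14667 and 18031 (`BlockClusteringAt … → CorePackageAt …`): YM-grade node; disprover work = junk-member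
  hunt on `AdmissiblePosAt` (begun §9c(iv): hard-core / winding rough factors, abelianised weights — none is a non-clustering member).
  (4) MERGE below 14667 via the Domination certificate: this crux disappears from the route and this file closes with it.
* Dead ends this cycle (one line each): none new — no earlier attack was repeated; the GROWTH certificate is a load-bearing /
  consistency result, not a kill attempt; the THR-side audit was re-checked once more at the definition level (`IsQCDAlong` carries
  `HasAsymptoticScaling` and the physical branch `m_f(k) > −1`, so THR does NOT admit fixed-`β` pion-only limits along the Wilson
  critical line; junk `z ≡ 0` / ultralocal white-noise limits are excluded by `IsNontrivial` / `IsNonGaussian` — 10th audit, no change).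
-/

section GrowthClause

variable {Nf : ℕ}

/-- Growth comparison behind `canonicalAF`: `(k+1) / (log (k+1)²)^γ → ∞` for every real `γ` (local copy of
`Negative.VolumeGrowth.tendsto_linear_div_log_sq_rpow`, LANDED p154859 but not yet built on the farm, hence not importable here). -/
theorem tendsto_linear_div_log_sq_rpow' (γ : ℝ) :
    Tendsto (fun k : ℕ => ((k : ℝ) + 1) / Real.log (((k : ℝ) + 1) ^ 2) ^ γ) atTop atTop := by
  have h1 : Tendsto (fun k : ℕ => ((k : ℝ) + 1) ^ 2) atTop atTop :=
    (tendsto_pow_atTop two_ne_zero).comp (tendsto_natCast_atTop_atTop.atTop_add tendsto_const_nhds)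
  have h2 : Tendsto (fun x : ℝ => Real.log x ^ γ / x ^ (1 / 2 : ℝ)) atTop (𝓝 0) :=
    (isLittleO_log_rpow_rpow_atTop γ (by norm_num : (0 : ℝ) < 1 / 2)).tendsto_div_nhds_zero
  have h3 : Tendsto (fun k : ℕ => Real.log (((k : ℝ) + 1) ^ 2) ^ γ / ((k : ℝ) + 1)) atTop (𝓝 0) := by
    refine (h2.comp h1).congr fun k => ?_
    simp only [Function.comp_def]
    rw [← Real.sqrt_eq_rpow, Real.sqrt_sq (by positivity)]
  have h4 : ∀ᶠ k : ℕ in atTop, Real.log (((k : ℝ) + 1) ^ 2) ^ γ / ((k : ℝ) + 1) ∈ Set.Ioi 0 := by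
    filter_upwards [eventually_ne_atTop 0] with k hk
    have hk1 : (1 : ℝ) ≤ k := by exact_mod_cast Nat.pos_of_ne_zero hk
    have hlog : 0 < Real.log (((k : ℝ) + 1) ^ 2) := Real.log_pos (by nlinarith)
    exact div_pos (Real.rpow_pos_of_pos hlog _) (by positivity)
  have h5 : Tendsto (fun k : ℕ => Real.log (((k : ℝ) + 1) ^ 2) ^ γ / ((k : ℝ) + 1)) atTop (𝓝[>] 0) :=
    tendsto_nhdsWithin_iff.2 ⟨h3, h4⟩
  refine h5.inv_tendsto_nhdsGT_zero.congr fun k => ?_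
  simp only [Pi.inv_apply, inv_div]

variable (Nf) in
/-- **§10a(ii): the junk witness meets GROWTH** — `canonicalAF` has `a_k L_k / Z_k → ∞` (local copy of
`Negative.VolumeGrowth.tendsto_canonicalAF_growth`). -/
theorem canonicalAF_growth :
    Tendsto (fun k => (QCDRegularisation.canonicalAF Nf).a k * (QCDRegularisation.canonicalAF Nf).L k /
      (QCDRegularisation.canonicalAF Nf).Zm k) atTop atTop := by
  refine (tendsto_linear_div_log_sq_rpow' (massExponent Nf)).congr' ?_
  filter_upwards [eventually_ne_atTop 0] with k hk
  have ha : (QCDRegularisation.canonicalAF Nf).a k = ((k : ℝ) + 1)⁻¹ := rfl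
  have hL : ((QCDRegularisation.canonicalAF Nf).L k : ℝ) = ((k : ℝ) + 1) ^ 2 := by
    change (((k + 1) ^ 2 : ℕ) : ℝ) = _
    push_cast
    ring
  have hZ : (QCDRegularisation.canonicalAF Nf).Zm k = Real.log (((k : ℝ) + 1) ^ 2) ^ massExponent Nf := by
    change (if k = 0 then (1 : ℝ) else Real.log (1 / (QCDScheme.zeroAF Nf).a k ^ 2) ^ massExponent Nf) = _
    rw [if_neg hk]
    congr 2
    change 1 / (((k : ℝ) + 1)⁻¹) ^ 2 = _
    rw [inv_pow, one_div, inv_inv]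
  rw [ha, hL, hZ]
  congr 1
  have hk1 : ((k : ℝ) + 1) ≠ 0 := by positivity
  field_simp

/-- **§10a(ii), LOAD-BEARING WITH GROWTH: replacing TIGHT⁺ by GROWTH collapses the bridge to `THR 2 ∧ THR 3`.**
The restated crux with its hypothesis `SD⁺` changed to "HMS ∧ HAS ∧ CAP ∧ BRANCH ∧ GROWTH ∧ EXTINCT above a threshold"
(TIGHT⁺ deleted, GROWTH added) is equivalent to its own conclusion at both flavour numbers: GROWTH is not junk-excluding,
and after its addition TIGHT⁺ remains the only clause from which a proof can extract fermionic input (§2, §7a). -/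
theorem bridgePlusGrowthWithoutTight_iff_thr :
    (∀ Nf : ℕ, (Nf = 2 ∨ Nf = 3) →
      (∃ reg : QCDRegularisation Nf, Tendsto (fun k => reg.a k * reg.L k / reg.Zm k) atTop atTop ∧
        reg.HasMassScaling ∧ (reg.scheme 0 0 0).HasAsymptoticScaling ∧
          (∃ p : ℕ, ∀ᶠ k : ℕ in Filter.atTop, (reg.L k : ℝ) ≤ (reg.a k)⁻¹ ^ p) ∧
            (∀ᶠ k : ℕ in Filter.atTop, -1 < reg.mcrit k) ∧ ∃ M₀ : ℝ, 0 ≤ M₀ ∧ ∃ c : ℝ, 0 < c ∧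
              ∀ m : Fin Nf → ℝ, (∀ f, M₀ < m f) → Extinct Nf reg c m) → THR Nf) ↔
      THR 2 ∧ THR 3 :=
  bridgePlus_collapse_schema (fun _ reg => Tendsto (fun k => reg.a k * reg.L k / reg.Zm k) atTop atTop)
    canonicalAF_growth

/-- **§10a(i): GROWTH supplies F's proviso at the scheme torus** (local one-regularisation copy of
`Negative.VolumeGrowth.bcProviso_eventually_of_growth`): if `a_k L_k/Z_k → ∞` then for every `C₀`, `c > 0`, `m > 0`,
eventually `C₀/(2L_k+1) < c·(a_k m/Z_k)` — compare `bcThreshold_eventually_false` (§8b) for the slow-volume family. -/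
theorem bcProviso_eventually_of_growth' (reg : QCDRegularisation Nf)
    (h : Tendsto (fun k => reg.a k * reg.L k / reg.Zm k) atTop atTop) (C₀ : ℝ) {c m : ℝ} (hc : 0 < c)
    (hm : 0 < m) :
    ∀ᶠ k : ℕ in atTop, C₀ / (2 * reg.L k + 1 : ℝ) < c * (reg.a k * m / reg.Zm k) := by
  filter_upwards [h.eventually_ge_atTop (C₀ / (c * m) + 1)] with k hk
  have ha := reg.a_pos k
  have hZ := reg.Zm_pos k
  have hN : (0 : ℝ) < 2 * reg.L k + 1 := by positivity
  have hcm : 0 < c * m := mul_pos hc hm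
  have h1 : C₀ < c * m * (reg.a k * reg.L k / reg.Zm k) := by
    have : C₀ / (c * m) < reg.a k * reg.L k / reg.Zm k := by linarith
    rwa [div_lt_iff₀' hcm] at this
  have h2 : c * m * (reg.a k * reg.L k / reg.Zm k) ≤ c * (reg.a k * m / reg.Zm k) * (2 * reg.L k + 1) := by
    have key : c * (reg.a k * m / reg.Zm k) * (2 * reg.L k + 1) - c * m * (reg.a k * reg.L k / reg.Zm k) =
        c * m * (reg.a k / reg.Zm k) * (reg.L k + 1) := by ring
    have : 0 ≤ c * m * (reg.a k / reg.Zm k) * (reg.L k + 1) := by positivity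
    linarith
  rw [div_lt_iff₀ hN]
  exact h1.trans_le h2

end GrowthClause

end Summit.QuantumFields.QCD.Cruxes.ExtinctionBuildsQCD.Disproof.Restated
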